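import Summits.BirchSwinnertonDyer.Rank1Residual.GaloisImage.SupersingularNonsplitCartanNormalizer
import Literature.NumberTheory.EllipticCurves.GeomReductionFrobeniusProofs
import Literature.NumberTheory.EllipticCurves.SerreOpenImageSupersingularInertiaProofs
import HarnessLib

/-!
# Route `SignedLowerHalves`, crux `KobayashiMainConjectureSmallImage` (item stmt-BirchSwinnertonDyer-19002):
# at a good SUPERSINGULAR odd `p`, an arithmetic Frobenius conjugates the inertia image on `E[p]`
# by the `p`-th power map — so it never centralises (never lies in) the inertia non-split Cartan
# subgroup (cell `bsd-ssimc`, seat `bsd-ssimc-k3-c4` gen 11, object «L4-INERT», part 1 of 2;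
# THEOREMS ONLY — no definition, no named fact, nothing booked; helper file `--supports` item 4)

PARTITION (cell bsd-ssimc): X7 (A7) × item 4's ENTIRE small-image domain (odd good supersingular
`p`, `ρ̄_{E,p}` not onto = the non-CM `X_ns⁺(p)` locus; every `p`, both ranks) — types-the-object-of
(the CM-shadow datum of the L4-CM / L4-JLK congruence road, class-wide); closes none; crux OPEN.
BSD is not proved by any of this.

## What this file proves (the arithmetic core; part 2 = `…SmallImageShadowInert.lean` packages it)

Let `E = W/ℚ` (global minimal model), `p ≠ 2` a prime of good reduction with `p ∣ a_p` (good
supersingular), `𝔔` a prime of `\bar ℤ` above `p`, `I_𝔔 ≤ Γ_ℚ` its inertia group and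
`σ ∈ Γ_ℚ` an ARITHMETIC FROBENIUS at `𝔔` (`IsArithFrobAt (𝓞 ℚ) σ 𝔔`: `σ x ≡ x^p (mod 𝔔)`).

* `smallImage_galoisRepTorsion_frob_conj_eq_pow_place`, `smallImage_galoisRepTorsion_frob_conj_eq_pow`
  — **the tame relation on `E[p]`: `ρ̄_{E,p}(σ s σ⁻¹) = ρ̄_{E,p}(s)^p` for every `s ∈ I_𝔔`**
  (Serre 1972 §1.11 Prop. 12: `I` acts on `E[p]` through the fundamental character of level `2`,
  on which Frobenius conjugation is `x ↦ x^p`, §1.7).  Proof at the place's prime (then conjugated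
  to every `𝔔 ∣ p`): with the tree's parameter `t = x/y` of the nonzero points of `E[p]`
  (`SerreOpenImageSupersingularParameterProofs`: all of valuation `1/(p²-1)`, pairwise at maximal
  distance) the map `τ ↦ θ(τ) = τ(t₀)/t₀ mod 𝔪` satisfies the cocycle rule
  `θ(τ₁τ₂) = τ₁(θ(τ₂))·θ(τ₁)`; inertia fixes residues (`valuation_smul_sub_lt_one_of_mem_inertia`)
  and `σ` raises them to the `p`-th power (`valuation_smul_sub_pow_lt_one_of_isArithFrobAt`), so
  `θ(σ s σ⁻¹ · s^{-p}) ≡ 1`, and an inertia element with `θ ≡ 1` fixes `E[p]` pointwise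
  (`smul_eq_self_of_valuation_smul_param_sub_lt`).
* `exists_not_commute_of_conj_eq_pow_of_isCyclic` — the GROUP-THEORETIC CORE, stated separately
  (planner D30-11 (2)(i)): an element acting on a cyclic subgroup of order `n` by `h ↦ h^q` with
  `n ∤ q - 1` does not centralise it.
* `smallImage_exists_inertia_not_commute_frob` — hence **`ρ̄(σ)` does not centralise `ρ̄(I_𝔔)`**
  (cyclic of order `p² - 1`, b2b `isCyclic_and_card_inertia_map_of_goodSS`; `p² - 1 ∤ p - 1`);
* `smallImage_frob_not_mem_unitGroup` — and in a frame `Φ : Aut(E[p]) ≃ GL₂(𝔽_p)`, **`Φ(ρ̄ σ)` lies in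
  NO non-split Cartan subgroup `kˣ` (`k ⊆ M₂(𝔽_p)` a field) containing `Φ(ρ̄(I_𝔔))`** — a field is
  commutative.  This is the local content of «`p` is INERT in the dihedral field» (part 2).

Why the cell wants it: on item 4's domain `ρ̄_{E,p} ≅ Ind_K χ̄` for an imaginary quadratic `K`
(b2b `exists_imaginary_index_two_subgroup_of_goodSS_of_not_surj`); the L4-CM / L4-JLK road
(k3c4-MEMO-2 and MEMO-9) replaces `E` by a CM newform `g = θ(ψ)` of `K`, and every signed-theory input on
the partner side — Lei 2011 assumption (1) `a_p(g) = 0`, Hatley–Lei 2019 (tor)/(BLZ) — holds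
BECAUSE `p` is inert in `K`.  Until now this was seam S6 of k3c4-MEMO-9 §2 («standard CFT; to be
cited when typed») and a per-pair NUMERICAL check (kit j272679, column `K`, 21 pairs; the 14
self-twist records of p512219 / p512877 pin `K` per pair but not the behaviour of `p` in it).
Parts 1–2 make it ONE class-wide kernel theorem on the whole `X_ns⁺(p)` locus, every `p`.

What is NOT here: the identification of `K` per pair (self-twist records, gen 10); any newform;
anything Iwasawa-theoretic; any claim at `p = 2`; nothing booked; crux 4 stays OPEN.

References: [Serre1972] §1.3 Prop. 1–2, §1.7, §1.11 Prop. 12, §2.2 Prop. 14; [SerreLocalFields1979]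
Ch. I §7–8, Ch. IV §1–2; [Kobayashi2003] Conjecture (p. 2); [Lei2011] §3 assumption (1);
[HatleyLei2019] Thm. 4.6, hypotheses (tor)/(BLZ).
-/

set_option autoImplicit false
set_option linter.dupNamespace false

noncomputable section

open scoped Classical NumberField Pointwise
open IsDedekindDomain Field Matrix NumberField WeierstrassCurve Literature.NumberTheory.EllipticCurves
  Literature.NumberTheory.GaloisRepresentations Rat.HeightOneSpectrum
  Literature.NumberTheory.EllipticCurves.Rank1Residual Summit.BirchSwinnertonDyer.Rank1Residual

namespace Summit.BirchSwinnertonDyer.BirchSwinnertonDyer.Theorems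

/-! ### The tame relation at the place's prime -/

set_option synthInstance.maxHeartbeats 400000 in
/-- **The tame relation on `E[p]` at a good supersingular prime, place form.**  Let `E = W/ℚ` be
globally minimal, `p ≠ 2` with `p ∤ Δ_min` and `p ∣ a_p`, `𝔓 = 𝔪_{placeOver p} ∩ \bar ℤ` the prime of
the place (`hmem`) above the place `v` of `ℚ` at `p`, `σ` an arithmetic Frobenius at `𝔓` and
`s ∈ I_𝔓`.  Then **`ρ̄_{E,p}(σ s σ⁻¹) = ρ̄_{E,p}(s)^p`** in `Aut(E[p])`: Frobenius conjugation is the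
`p`-th power map on the (cyclic, tame) inertia image.  Proof via the tame character
`θ(τ) = τ(t₀)/t₀ (mod 𝔪)` of the parameter `t₀ = x₀/y₀` of a nonzero `p`-torsion point (see the
module docstring): `θ(σ s σ⁻¹ s^{-p}) ≡ θ(s)^p θ(s)^{-p} = 1`, and an inertia element moving `t₀` by
less than `v(t₀)` fixes `E[p]`. [cite: Serre1972, §1.7 and §1.11 Prop. 12] -/
theorem smallImage_galoisRepTorsion_frob_conj_eq_pow_place
    (W : WeierstrassCurve ℚ) [W.IsElliptic] [W.IsGloballyMinimal] (p : ℕ) [Fact p.Prime]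
    (hp2 : p ≠ 2) (hΔ : ¬ (p : ℤ) ∣ minimalDiscriminantInt W) (hss : (p : ℤ) ∣ W.frobeniusTrace p)
    {v : HeightOneSpectrum (𝓞 ℚ)} (hv : (primesEquiv v : ℕ) = p)
    {𝔓 : Ideal (absIntegers (𝓞 ℚ) ℚ)}
    (hmem : ∀ x : absIntegers (𝓞 ℚ) ℚ, x ∈ 𝔓 ↔ (x : AlgebraicClosure ℚ) ∈ (placeOver p).nonunits)
    (h𝔓 : 𝔓 ∈ v.primesAbove)
    {σ : absoluteGaloisGroup ℚ} (hσ : IsArithFrobAt (𝓞 ℚ) σ 𝔓)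
    {s : absoluteGaloisGroup ℚ} (hs : s ∈ 𝔓.inertia (absoluteGaloisGroup ℚ)) :
    galoisRepTorsion W p (σ * s * σ⁻¹) = galoisRepTorsion W p s ^ p := by
  have hpP : p.Prime := Fact.out
  haveI : 𝔓.IsPrime := h𝔓.1
  set val := (placeOver p).valuation with hval
  set I := 𝔓.inertia (absoluteGaloisGroup ℚ) with hI
  set ρ := galoisRepTorsion W p with hρ
  set r := placeResidueMap p with hr
  -- `σ` stabilises `𝔓`; conjugates of inertia elements are inertia elements
  have hσ𝔓 : σ • 𝔓 = 𝔓 := hσ.mem_stabilizer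
  have hσ𝔓' : σ⁻¹ • 𝔓 = 𝔓 := by
    conv_lhs => rw [← hσ𝔓]
    rw [inv_smul_smul]
  have hconj : σ * s * σ⁻¹ ∈ I := by
    have hs' : s ∈ (σ⁻¹ • 𝔓).inertia (absoluteGaloisGroup ℚ) := by rwa [hσ𝔓']
    have := DegreeOnePrimes.conj_mem_inertia_of_mem_inertia_smul hs'
    rwa [inv_inv] at this
  -- the element `g = σ s σ⁻¹ · (s^p)⁻¹ ∈ I`; it suffices to show `ρ̄ g = 1`
  have hspI : s ^ p ∈ I := I.pow_mem hs p
  set g := σ * s * σ⁻¹ * (s ^ p)⁻¹ with hgdef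
  have hgI : g ∈ I := I.mul_mem hconj (I.inv_mem hspI)
  suffices hg1 : ρ g = 1 by
    have : σ * s * σ⁻¹ = g * s ^ p := by rw [hgdef, inv_mul_cancel_right]
    rw [this, map_mul, hg1, one_mul, map_pow]
  -- integrality tests at the place
  have hmem1 : ∀ {z : AlgebraicClosure ℚ}, val z = 1 → z ∈ placeOver p := fun hz ↦
    (ValuationSubring.valuation_le_one_iff _ _).mp hz.le
  have hres1 : ∀ {a : placeOver p}, r a = 1 ↔ val ((a : AlgebraicClosure ℚ) - 1) < 1 := by
    intro a
    rw [← (placeResidueMap p).map_one]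
    constructor
    · intro h
      have : r (a - 1) = 0 := by rw [map_sub, h, map_one, sub_self]
      rwa [hr, placeResidueMap_eq_zero_iff] at this
    · intro h
      exact placeResidueMap_eq_of_valuation_sub_lt p h
  -- a nonzero torsion point `P₀ = (x₀, y₀)` and its parameter `t₀`
  letI : Module (ZMod p) (geomTorsion W p) := AddSubgroup.torsionBy.zmodModule
  have hp0' : (p : AlgebraicClosure ℚ) ≠ 0 := Nat.cast_ne_zero.mpr hpP.ne_zero
  have hcard : Nat.card (geomTorsion W p) = p ^ 2 :=
    card_torsionPoints_eq_sq_holds W (AlgebraicClosure ℚ) (n := p) hp0'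
  haveI : Finite (geomTorsion W p) :=
    Nat.finite_of_card_ne_zero (by rw [hcard]; exact pow_ne_zero _ hpP.ne_zero)
  haveI : Nontrivial (geomTorsion W p) := Finite.one_lt_card_iff_nontrivial.mp (by
    rw [hcard]; nlinarith [hpP.two_le])
  obtain ⟨P₀, hP₀0⟩ := exists_ne (0 : geomTorsion W p)
  have hP₀0' : (P₀ : W.geomPoints) ≠ 0 := fun h ↦ hP₀0 (Subtype.ext h)
  obtain ⟨x₀, y₀, h₀, hP₀xy⟩ := geomPoints.exists_eq_some (P := (P₀ : W.geomPoints)) hP₀0'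
  have hP₀t : (p : ℤ) • (P₀ : W.geomPoints) = 0 := (Submodule.mem_torsionBy_iff _ _).mp P₀.2
  set t₀ := x₀ / y₀ with ht₀def
  obtain ⟨ht₀1, ht₀n⟩ := valuation_param_pow_eq p hΔ hss hp2 hP₀t hP₀xy
  rw [← ht₀def] at ht₀1 ht₀n
  have hvp0 : val p ≠ 0 := by rw [hval, Valuation.ne_zero_iff]; exact_mod_cast hpP.ne_zero
  have ht₀0 : val t₀ ≠ 0 := by
    intro h0
    have hn0 : p ^ 2 - 1 ≠ 0 := by
      have : 4 ≤ p ^ 2 := by nlinarith [hpP.two_le]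
      omega
    rw [h0, zero_pow hn0] at ht₀n
    exact hvp0 ht₀n.symm
  have ht₀ne : t₀ ≠ 0 := fun h ↦ ht₀0 (by rw [h, map_zero])
  -- every Galois conjugate of `t₀` is the parameter of a torsion point: same valuation
  have hsP : ∀ τ : absoluteGaloisGroup ℚ, ∃ h', ((τ • P₀ : geomTorsion W p) : W.geomPoints) =
      .some (τ • x₀) (τ • y₀) h' := fun τ ↦ exists_smul_eq_some (W := W) τ hP₀xy
  have hsPt : ∀ τ : absoluteGaloisGroup ℚ, (p : ℤ) • ((τ • P₀ : geomTorsion W p) : W.geomPoints) =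
      0 := fun τ ↦ (Submodule.mem_torsionBy_iff _ _).mp (τ • P₀).2
  have hvs : ∀ τ : absoluteGaloisGroup ℚ, val (τ • t₀) = val t₀ := by
    intro τ
    obtain ⟨h', hs'⟩ := hsP τ
    have := valuation_param_eq_of_zsmul_eq_zero p hΔ hss hp2 (hsPt τ) hP₀t hs' hP₀xy
    rwa [smul_div_eq] at this
  -- the tame character `θ(τ) = τ t₀ / t₀`, a unit at the place
  set θ : absoluteGaloisGroup ℚ → AlgebraicClosure ℚ := fun τ ↦ τ • t₀ / t₀ with hθ
  have hθv : ∀ τ, val (θ τ) = 1 := fun τ ↦ by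
    rw [hθ]; dsimp only; rw [map_div₀, hvs, div_self ht₀0]
  have hθmem : ∀ τ, θ τ ∈ placeOver p := fun τ ↦ hmem1 (hθv τ)
  have hθne : ∀ τ, θ τ ≠ 0 := fun τ h ↦ by
    have := hθv τ; rw [h, map_zero] at this; exact zero_ne_one this
  set u : absoluteGaloisGroup ℚ → placeOver p := fun τ ↦ ⟨θ τ, hθmem τ⟩ with hu
  have hu0 : ∀ τ, r (u τ) ≠ 0 := fun τ ↦ by
    rw [Ne, hr, placeResidueMap_eq_zero_iff]
    exact (hθv τ).symm ▸ lt_irrefl 1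
  have hst₀ : ∀ τ : absoluteGaloisGroup ℚ, τ • t₀ = θ τ * t₀ := fun τ ↦ by
    rw [hθ]; dsimp only; rw [div_mul_cancel₀ _ ht₀ne]
  -- the cocycle relation `θ(τ₁ τ₂) = τ₁(θ τ₂) · θ(τ₁)`
  have hcoc : ∀ τ₁ τ₂ : absoluteGaloisGroup ℚ, θ (τ₁ * τ₂) = τ₁ • θ τ₂ * θ τ₁ := by
    intro τ₁ τ₂
    have h1 : (τ₁ * τ₂) • t₀ = τ₁ • θ τ₂ * θ τ₁ * t₀ := by
      rw [mul_smul, hst₀ τ₂, smul_mul', hst₀ τ₁, mul_assoc]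
    have h2 : θ (τ₁ * τ₂) * t₀ = τ₁ • θ τ₂ * θ τ₁ * t₀ := by rw [← hst₀, h1]
    exact mul_right_cancel₀ ht₀ne h2
  -- inertia: stabilises the place and fixes residues
  have hsmem : ∀ {a : absoluteGaloisGroup ℚ}, a ∈ I → ∀ {z : AlgebraicClosure ℚ},
      z ∈ placeOver p → a • z ∈ placeOver p := by
    intro a ha z hz
    have hstab := smul_placeOver_eq_of_mem_inertia (p := p) hmem ha
    rw [← hstab, absoluteGaloisGroup.smul_def]
    exact ValuationSubring.smul_mem_pointwise_smul _ _ _ hz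
  have hfix : ∀ {a : absoluteGaloisGroup ℚ}, a ∈ I → ∀ (z : AlgebraicClosure ℚ)
      (hz : z ∈ placeOver p) (haz : a • z ∈ placeOver p), r ⟨a • z, haz⟩ = r ⟨z, hz⟩ :=
    fun ha z hz haz ↦ placeResidueMap_eq_of_valuation_sub_lt p
      (valuation_smul_sub_lt_one_of_mem_inertia hmem ha hz)
  -- Frobenius: stabilises the place and raises residues to the `p`-th power
  have hσmem : ∀ {z : AlgebraicClosure ℚ}, z ∈ placeOver p → σ • z ∈ placeOver p := by
    intro z hz
    have hstab := smul_placeOver_eq_of_isArithFrobAt (p := p) hmem h𝔓 hσ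
    rw [← hstab, absoluteGaloisGroup.smul_def]
    exact ValuationSubring.smul_mem_pointwise_smul _ _ _ hz
  have hfrob : ∀ (z : AlgebraicClosure ℚ) (hz : z ∈ placeOver p) (hσz : σ • z ∈ placeOver p),
      r ⟨σ • z, hσz⟩ = r ⟨z, hz⟩ ^ p := by
    intro z hz hσz
    rw [← map_pow]
    apply placeResidueMap_eq_of_valuation_sub_lt p
    rw [SubmonoidClass.coe_pow]
    exact valuation_smul_sub_pow_lt_one_of_isArithFrobAt (p := p) hmem hv h𝔓 hσ hz
  -- `Θ = θ mod 𝔪`: multiplicative against inertia on the left, Frobenius-twisted against `σ`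
  have hmulI : ∀ {a : absoluteGaloisGroup ℚ}, a ∈ I → ∀ b : absoluteGaloisGroup ℚ,
      r (u (a * b)) = r (u a) * r (u b) := by
    intro a ha b
    have habmem : a • θ b ∈ placeOver p := hsmem ha (hθmem b)
    have heq : u (a * b) = ⟨a • θ b, habmem⟩ * u a := Subtype.ext (hcoc a b)
    rw [heq, map_mul, hfix ha (θ b) (hθmem b) habmem, mul_comm]
  have hmulσ : ∀ b : absoluteGaloisGroup ℚ, r (u (σ * b)) = r (u b) ^ p * r (u σ) := by
    intro b
    have hσbmem : σ • θ b ∈ placeOver p := hσmem (hθmem b)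
    have heq : u (σ * b) = ⟨σ • θ b, hσbmem⟩ * u σ := Subtype.ext (hcoc σ b)
    rw [heq, map_mul, hfrob (θ b) (hθmem b) hσbmem]
  have hone : r (u 1) = 1 := by
    have : u 1 = 1 := Subtype.ext (by
      change (1 : absoluteGaloisGroup ℚ) • t₀ / t₀ = 1
      rw [one_smul, div_self ht₀ne])
    rw [this, map_one]
  have hinvI : ∀ {a : absoluteGaloisGroup ℚ}, a ∈ I → r (u a⁻¹) = (r (u a))⁻¹ := by
    intro a ha
    have h := hmulI (I.inv_mem ha) a
    rw [inv_mul_cancel, hone] at h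
    exact eq_inv_of_mul_eq_one_left h.symm
  have hpowI : ∀ {a : absoluteGaloisGroup ℚ}, a ∈ I → ∀ n : ℕ, r (u (a ^ n)) = r (u a) ^ n := by
    intro a ha n
    induction n with
    | zero => rw [pow_zero, pow_zero, hone]
    | succ n ih => rw [pow_succ', hmulI ha, ih, pow_succ']
  have hσinv : r (u σ⁻¹) ^ p * r (u σ) = 1 := by
    have h := hmulσ σ⁻¹
    rw [mul_inv_cancel, hone] at h
    exact h.symm
  -- `Θ(σ s σ⁻¹) = Θ(s)^p`
  have hΘconj : r (u (σ * s * σ⁻¹)) = r (u s) ^ p := by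
    rw [mul_assoc, hmulσ (s * σ⁻¹), hmulI hs σ⁻¹, mul_pow, mul_assoc, hσinv, mul_one]
  -- `Θ(g) = 1`
  have hΘg : r (u g) = 1 := by
    rw [hgdef, hmulI hconj, hΘconj, hinvI hspI, hpowI hs p, mul_inv_cancel₀]
    exact pow_ne_zero _ (hu0 s)
  -- hence `g` moves `t₀` by less than `v(t₀)`, so it fixes `E[p]`
  have hlt : val (g • t₀ - t₀) < val t₀ := by
    have h1 : val (θ g - 1) < 1 := hres1.mp hΘg
    have h2 : g • t₀ - t₀ = (θ g - 1) * t₀ := by rw [hst₀ g, sub_mul, one_mul]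
    rw [h2, map_mul]
    calc val (θ g - 1) * val t₀ < 1 * val t₀ := by
          exact mul_lt_mul_of_pos_right h1 (zero_lt_iff.mpr ht₀0)
      _ = val t₀ := one_mul _
  have hfixP : ∀ P : geomTorsion W p, g • P = P :=
    smul_eq_self_of_valuation_smul_param_sub_lt p hΔ hss hp2 hmem hgI hP₀t hP₀xy hlt
  exact (galoisRepTorsion_eq_one_iff' W (p : ℤ) g).mpr hfixP

/-! ### The tame relation at every prime above `p`, and its consequences -/

set_option synthInstance.maxHeartbeats 400000 in
/-- **The tame relation on `E[p]` at a good supersingular prime `p ≠ 2`, at EVERY prime `𝔔 ∣ p` of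
`\bar ℤ`**: for an arithmetic Frobenius `σ` at `𝔔` and `s ∈ I_𝔔`, `ρ̄_{E,p}(σ s σ⁻¹) = ρ̄_{E,p}(s)^p`
(`p ∤ Δ_min`, `p ∣ a_p`).  The primes above `p` are conjugate (`exists_smul_eq_of_mem_primesAbove_holds`)
and both sides transform alike under conjugation (`IsArithFrobAt.conj`,
`DegreeOnePrimes.conj_mem_inertia_of_mem_inertia_smul`), so this is the place form moved to `𝔔`.
[cite: Serre1972, §1.7 and §1.11 Prop. 12] -/
theorem smallImage_galoisRepTorsion_frob_conj_eq_pow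
    (W : WeierstrassCurve ℚ) [W.IsElliptic] [W.IsGloballyMinimal] (p : ℕ) [Fact p.Prime]
    (hp2 : p ≠ 2) (hΔ : ¬ (p : ℤ) ∣ minimalDiscriminantInt W) (hss : (p : ℤ) ∣ W.frobeniusTrace p)
    {v : HeightOneSpectrum (𝓞 ℚ)} (hv : (primesEquiv v : ℕ) = p)
    {𝔔 : Ideal (absIntegers (𝓞 ℚ) ℚ)} (h𝔔 : 𝔔 ∈ v.primesAbove)
    {σ : absoluteGaloisGroup ℚ} (hσ : IsArithFrobAt (𝓞 ℚ) σ 𝔔)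
    {s : absoluteGaloisGroup ℚ} (hs : s ∈ 𝔔.inertia (absoluteGaloisGroup ℚ)) :
    galoisRepTorsion W p (σ * s * σ⁻¹) = galoisRepTorsion W p s ^ p := by
  obtain ⟨𝔓, hmem, h𝔓⟩ := exists_ideal_placeOver p hv
  obtain ⟨g, hg⟩ :=
    HeightOneSpectrum.exists_smul_eq_of_mem_primesAbove_holds (K := ℚ) (v := v) h𝔓 h𝔔
  -- move `σ`, `s` to the place's prime `𝔓 = g⁻¹ • 𝔔`
  have hg' : g⁻¹ • 𝔔 = 𝔓 := by rw [← hg, inv_smul_smul]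
  have hσ' : IsArithFrobAt (𝓞 ℚ) (g⁻¹ * σ * g⁻¹⁻¹) 𝔓 := hg' ▸ hσ.conj g⁻¹
  have hs' : g⁻¹ * s * g ∈ 𝔓.inertia (absoluteGaloisGroup ℚ) := by
    rw [← hg] at hs
    exact DegreeOnePrimes.conj_mem_inertia_of_mem_inertia_smul hs
  have key := smallImage_galoisRepTorsion_frob_conj_eq_pow_place W p hp2 hΔ hss hv hmem h𝔓 hσ' hs'
  rw [inv_inv] at key
  have h1 : g⁻¹ * σ * g * (g⁻¹ * s * g) * (g⁻¹ * σ * g)⁻¹ = g⁻¹ * (σ * s * σ⁻¹) * g⁻¹⁻¹ := by group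
  have h2 : g⁻¹ * s * g = g⁻¹ * s * g⁻¹⁻¹ := by rw [inv_inv]
  rw [h1, h2] at key
  simp only [map_mul, map_inv] at key
  rw [conj_pow] at key
  have key' := mul_left_cancel (mul_right_cancel key)
  simp only [map_mul, map_inv]
  exact key'

/-- **Group-theoretic core.** In a group `G`, let `H ≤ G` be cyclic of finite order `n` and let
`x ∈ G` act on `H` by conjugation as the `q`-th power map (`x h x⁻¹ = h^q` for `h ∈ H`, `q ≥ 1`).
If `n ∤ q - 1` then `x` does NOT centralise `H`: some `h ∈ H` has `x h ≠ h x`.  (If `x` commuted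
with `H`, every `h ∈ H` would satisfy `h^q = h`, i.e. `h^{q-1} = 1`, so the order `n` of a generator
would divide `q - 1`.)  Used with `H = ρ̄_{E,p}(I_𝔔)` (cyclic of order `p² - 1`), `x = ρ̄_{E,p}(Frob)`,
`q = p`. [folklore] -/
theorem exists_not_commute_of_conj_eq_pow_of_isCyclic {G : Type*} [Group G] {H : Subgroup G}
    (hcyc : IsCyclic H) {n q : ℕ} (hcard : Nat.card H = n) (hq : 1 ≤ q) (hnq : ¬ n ∣ q - 1)
    {x : G} (hconj : ∀ h ∈ H, x * h * x⁻¹ = h ^ q) : ∃ h ∈ H, x * h ≠ h * x := by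
  by_contra hall
  push Not at hall
  -- every element of `H` has order dividing `q - 1`
  have hexp : ∀ h : H, h ^ (q - 1) = 1 := by
    rintro ⟨h, hh⟩
    have hfix : h ^ q = h := by rw [← hconj h hh, hall h hh, mul_inv_cancel_right]
    have hq1 : q - 1 + 1 = q := Nat.sub_add_cancel hq
    have h1 : h ^ (q - 1) * h = 1 * h := by rw [← pow_succ, hq1, hfix, one_mul]
    exact Subtype.ext (by
      rw [SubmonoidClass.coe_pow, OneMemClass.coe_one]
      exact mul_right_cancel h1)
  -- so does the order `n` of a generator
  obtain ⟨γ, hγ⟩ := hcyc.exists_generator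
  have hord : orderOf γ = n := by
    rw [← hcard, ← Nat.card_zpowers, (Subgroup.eq_top_iff' _).mpr hγ, Subgroup.card_top]
  exact hnq (hord ▸ orderOf_dvd_of_pow_eq_one (hexp γ))

/-- **An arithmetic Frobenius does not centralise the inertia image on `E[p]`.**  At a good
supersingular `p ≠ 2` (`GoodSS W p`, `W` globally minimal), for every prime `𝔔 ∣ p` of `\bar ℤ` and
every arithmetic Frobenius `σ` at `𝔔` there is `s ∈ I_𝔔` with `ρ̄(σ) ρ̄(s) ≠ ρ̄(s) ρ̄(σ)`: the image
`ρ̄(I_𝔔)` is cyclic of order `p² - 1` (b2b `isCyclic_and_card_inertia_map_of_goodSS`, Serre Prop. 12 c),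
`ρ̄(σ)` acts on it by `h ↦ h^p` (`smallImage_galoisRepTorsion_frob_conj_eq_pow`), and `p² - 1 ∤ p - 1`.
In Serre's words: the image of the decomposition group is the NORMALISER of the non-split Cartan
subgroup `ρ̄(I)`, not the Cartan subgroup itself. [cite: Serre1972, §1.11 Prop. 12 and §2.2] -/
theorem smallImage_exists_inertia_not_commute_frob
    (W : WeierstrassCurve ℚ) [W.IsElliptic] [W.IsGloballyMinimal] (p : ℕ) [Fact p.Prime]
    (hp2 : p ≠ 2) (hss : GoodSS W p)
    {v : HeightOneSpectrum (𝓞 ℚ)} (hv : (primesEquiv v : ℕ) = p)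
    {𝔔 : Ideal (absIntegers (𝓞 ℚ) ℚ)} (h𝔔 : 𝔔 ∈ v.primesAbove)
    {σ : absoluteGaloisGroup ℚ} (hσ : IsArithFrobAt (𝓞 ℚ) σ 𝔔) :
    ∃ s ∈ 𝔔.inertia (absoluteGaloisGroup ℚ),
      galoisRepTorsion W p σ * galoisRepTorsion W p s ≠
        galoisRepTorsion W p s * galoisRepTorsion W p σ := by
  have hpP : p.Prime := Fact.out
  have hΔ := W.not_dvd_minimalDiscriminantInt_of_hasGoodReductionAtPrime' p hss.1
  obtain ⟨hcyc, hcard⟩ := GaloisImage.isCyclic_and_card_inertia_map_of_goodSS W p hp2 hss hv h𝔔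
  -- `p² - 1 ∤ p - 1`
  have hnd : ¬ p ^ 2 - 1 ∣ p - 1 := by
    intro hdvd
    have hle : p ^ 2 - 1 ≤ p - 1 := Nat.le_of_dvd (by have := hpP.two_le; omega) hdvd
    have hlt : p < p ^ 2 := by nlinarith [hpP.two_le]
    have h1 : p ≤ p ^ 2 - 1 := Nat.le_sub_one_of_lt hlt
    have h2 : p - 1 < p := Nat.sub_lt hpP.pos Nat.one_pos
    exact absurd (h1.trans hle) (not_le.mpr h2)
  -- the conjugation action of `ρ̄ σ` on the inertia image is the `p`-th power map
  have hconj : ∀ h ∈ (𝔔.inertia (absoluteGaloisGroup ℚ)).map (galoisRepTorsion W p),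
      galoisRepTorsion W p σ * h * (galoisRepTorsion W p σ)⁻¹ = h ^ p := by
    rintro _ ⟨s, hs, rfl⟩
    rw [← map_inv, ← map_mul, ← map_mul]
    exact smallImage_galoisRepTorsion_frob_conj_eq_pow W p hp2 hΔ hss.2 hv h𝔔 hσ hs
  obtain ⟨_, ⟨s, hs, rfl⟩, hne⟩ :=
    exists_not_commute_of_conj_eq_pow_of_isCyclic hcyc hcard hpP.one_le hnd hconj
  exact ⟨s, hs, hne⟩

/-- **Frame form: an arithmetic Frobenius at `𝔔 ∣ p` lies in NO non-split Cartan subgroup containing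
the inertia image.**  For a frame `Φ : Aut(E[p]) ≃ GL₂(𝔽_p)` and a subalgebra `k ⊆ M₂(𝔽_p)` which is
a FIELD with `Φ(ρ̄(I_𝔔)) ≤ kˣ` (`Serre1972.unitGroup k`; at a good supersingular `p` the inertia image
IS such a `kˣ`, b2b `exists_unitGroup_eq_inertia_image_of_goodSS`): `Φ(ρ̄ σ) ∉ kˣ` — elements of the
commutative `k` commute, `ρ̄ σ` and `ρ̄(I_𝔔)` do not (`smallImage_exists_inertia_not_commute_frob`).
[cite: Serre1972, §1.11 Prop. 12, §2.1 b) and §2.2] -/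
theorem smallImage_frob_not_mem_unitGroup
    (W : WeierstrassCurve ℚ) [W.IsElliptic] [W.IsGloballyMinimal] (p : ℕ) [Fact p.Prime]
    (Φ : Multiplicative (AddAut (geomTorsion W p)) ≃* GL (Fin 2) (ZMod p))
    (hp2 : p ≠ 2) (hss : GoodSS W p)
    {v : HeightOneSpectrum (𝓞 ℚ)} (hv : (primesEquiv v : ℕ) = p)
    {𝔔 : Ideal (absIntegers (𝓞 ℚ) ℚ)} (h𝔔 : 𝔔 ∈ v.primesAbove)
    {σ : absoluteGaloisGroup ℚ} (hσ : IsArithFrobAt (𝓞 ℚ) σ 𝔔)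
    {k : Subalgebra (ZMod p) (Matrix (Fin 2) (Fin 2) (ZMod p))} (hk : IsField k)
    (hIk : ((𝔔.inertia (absoluteGaloisGroup ℚ)).map (galoisRepTorsion W p)).map Φ.toMonoidHom ≤
      Serre1972.unitGroup k) :
    Φ (galoisRepTorsion W p σ) ∉ Serre1972.unitGroup k := by
  intro hσk
  obtain ⟨s, hs, hne⟩ := smallImage_exists_inertia_not_commute_frob W p hp2 hss hv h𝔔 hσ
  apply hne
  have hsk : Φ (galoisRepTorsion W p s) ∈ Serre1972.unitGroup k :=
    hIk ⟨galoisRepTorsion W p s, ⟨s, hs, rfl⟩, rfl⟩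
  rw [Serre1972.mem_unitGroup_iff] at hσk hsk
  have hcomm : ((Φ (galoisRepTorsion W p σ) : GL (Fin 2) (ZMod p)) : Matrix (Fin 2) (Fin 2) (ZMod p)) *
      ((Φ (galoisRepTorsion W p s) : GL (Fin 2) (ZMod p)) : Matrix (Fin 2) (Fin 2) (ZMod p)) =
      ((Φ (galoisRepTorsion W p s) : GL (Fin 2) (ZMod p)) : Matrix (Fin 2) (Fin 2) (ZMod p)) *
      ((Φ (galoisRepTorsion W p σ) : GL (Fin 2) (ZMod p)) : Matrix (Fin 2) (Fin 2) (ZMod p)) :=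
    congrArg Subtype.val (hk.mul_comm ⟨_, hσk⟩ ⟨_, hsk⟩)
  have hcommGL : Φ (galoisRepTorsion W p σ) * Φ (galoisRepTorsion W p s) =
      Φ (galoisRepTorsion W p s) * Φ (galoisRepTorsion W p σ) :=
    Units.ext (by rw [Units.val_mul, Units.val_mul]; exact hcomm)
  exact Φ.injective (by rw [map_mul, map_mul, hcommGL])

end Summit.BirchSwinnertonDyer.BirchSwinnertonDyer.Theorems

end
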